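import Literature.Geometry.Kaehler.RegularPointStraightening
import Literature.Geometry.Kaehler.AnalyticSetSingularLocusCodim
import Literature.Geometry.Kaehler.AnalyticSetBranchLocus
import Literature.Geometry.Kaehler.AnalyticSetProofs
import Literature.AlgebraicTopology.SingularHomology.LocallyFlatComplement
import Literature.AlgebraicTopology.SingularHomology.HighCodimensionComplement
import HarnessLib

/-!
# Semipurity for analytic subsets of complex manifolds: `H_q(W ∖ T) → H_q(W)` below `2 codim T`

Topic `Literature/Geometry/Kaehler`. C. Voisin, *Hodge Theory and Complex Algebraic Geometry I*
(2002), §11.1.2, Lemma 11.13 ("`Hˡ(X) → Hˡ(X − Y)` is an isomorphism for `l ≤ 2r`", `Y` a closed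
complex submanifold of codimension `> r`) applied along the singular stratification of an analytic
set (§11.1.1 Thm. 11.11 for algebraic sets; for analytic sets: Cartan–Whitney, `sng A` is analytic
of smaller dimension, E. M. Chirka, *Complex Analytic Sets* (1989), §5.2 Thm. 2). The tree has the
ALGEBRAIC instance (`Literature.AlgebraicGeometry.HodgeTheory.surjective_map_complexPointsCompl_of_le_coheight`,
file `HodgeTheory/SupportedClassesSemipurity`: `Hᵢ((X ∖ Z)(ℂ)) ↠ Hᵢ(X(ℂ))`, `i < 2c`, `Z`
Zariski-closed of codimension `≥ c`); this file PROVES the ANALYTIC one, on an arbitrary second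
countable complex manifold `N` charted on a finite-dimensional complex space `E` and RELATIVE to an
open subset `W ⊆ N` (the form consumed by long exact sequences of triples):

* `IsAnalyticSet.surjective_injective_map_diff` — **for `T ⊆ N` analytic all of whose regular
  points have codimension `≥ c₀`, and every open `W ⊆ N`, the map `H_q(W ∖ T; M) → H_q(W; M)`
  induced by the inclusion is onto for `q < 2c₀` and one-to-one for `q + 1 < 2c₀`** (any
  coefficients).

Proof (as printed, without tubular neighbourhoods): along the finite stratification
`T = T₀ ⊇ T₁ = sng T₀ ⊇ T₂ = sng T₁ ⊇ ⋯ ⊇ T_K = ∅` (Cartan–Whitney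
`isAnalyticSet_singularLocus_holds`; codimensions increase, `IsAnalyticSet.succ_le_codim_singularLocus`,
so `T_K = ∅` for `K = dim N + 1`, `IsAnalyticSet.eq_empty_of_finrank_lt_codim`), by downward
induction on `k`: in the open subspace `W ∖ T_{k+1}` the closed subset `T_k ∖ T_{k+1} = reg T_k`
is straightened at each point by a holomorphic implicit-function chart of real codimension
`2q ≥ 2c₀` (`IsRegularPointOfCodim.exists_straightening`, `RegularPointStraightening`), so the
tree's tubular-neighbourhood-free engine (`surjective_injective_map_compl_of_locallyFlat`,
`SingularHomology/LocallyFlatComplement`) makes `H_q(W ∖ T_k) → H_q(W ∖ T_{k+1})` onto /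
one-to-one in the stated ranges; compose with the induction hypothesis. Theorems only; no named
facts.

## References

* C. Voisin, *Hodge Theory and Complex Algebraic Geometry I* (2002), §11.1.2 Lemma 11.13,
  §11.1.1 Thm. 11.11. [VoisinHodgeI2002]
* E. M. Chirka, *Complex Analytic Sets* (1989), §5.2 Thm. 2. [Chirka1989]
* A. Hatcher, *Algebraic Topology* (2002), §3.3 proof of Thm. 3.35. [HatcherAT2002]
-/

noncomputable section

open scoped Manifold ContDiff Topology
open Set TopologicalSpace Function
open Literature.AlgebraicTopology.SingularHomology

universe v

namespace Literature.Geometry.Kaehler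

variable (R : Type v) [CommRing R] (M : Type v) [AddCommGroup M] [Module R M]
variable {E : Type} [NormedAddCommGroup E] [NormedSpace ℂ E] [FiniteDimensional ℂ E]
  {N : Type} [TopologicalSpace N] [ChartedSpace E N] [IsManifold 𝓘(ℂ, E) 1 N]

/-! ### Transport of onto / one-to-one along homeomorphic inclusions -/

omit [FiniteDimensional ℂ E] [IsManifold 𝓘(ℂ, E) 1 N] [ChartedSpace E N] in
/-- The inclusion `W ∖ ∅ ↪ W` induces a bijection on homology (it is a homeomorphism).
[cite: HatcherAT2002, §2.1] -/
theorem surjective_injective_map_diff_empty (W : Set N) (q : ℕ) :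
    Function.Surjective
        (singularHomology.map R M (subsetInclusion (sdiff_subset : W \ ∅ ⊆ W)) q) ∧
      Function.Injective
        (singularHomology.map R M (subsetInclusion (sdiff_subset : W \ ∅ ⊆ W)) q) := by
  have hc : ((Homeomorph.refl ↥W : ↥W ≃ₜ ↥W) : C(↥W, ↥W)).comp
      (subsetInclusion (sdiff_subset : W \ ∅ ⊆ W)) =
      (ContinuousMap.id ↥W).comp
        ((Homeomorph.setCongr (sdiff_empty : W \ ∅ = W) : ↥(W \ ∅) ≃ₜ ↥W) : C(↥(W \ ∅), ↥W)) :=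
    ContinuousMap.ext fun _ ↦ rfl
  refine ⟨(surjective_map_iff_of_homeomorph R M _ _ _ _ hc q).2 ?_,
    (injective_map_iff_of_homeomorph R M _ _ _ _ hc q).2 ?_⟩
  · rw [singularHomology.map_id]; exact Function.surjective_id
  · rw [singularHomology.map_id]; exact Function.injective_id

omit [FiniteDimensional ℂ E] [IsManifold 𝓘(ℂ, E) 1 N] [ChartedSpace E N] in
/-- **One stratum.** Let `W ⊆ N` be open, `T₁ ⊆ T₀` closed, and suppose that in the open subspace
`X = W ∖ T₁` the closed subset `{x | x ∈ T₀}` is locally flat of real codimension `≥ k`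
(straightening charts `X ⇀ F × K`, `k ≤ dim F`). Then `H_q(W ∖ T₀) → H_q(W ∖ T₁)` is onto for
`q < k` and one-to-one for `q + 1 < k` (the tree's engine `surjective_injective_map_compl_of_locallyFlat`
on `X`, transported along `{x : X | x ∉ T₀} ≃ W ∖ T₀`). [cite: VoisinHodgeI2002, §11.1.2 Lemma 11.13]
[cite: HatcherAT2002, §3.3 proof of Thm. 3.35] -/
theorem surjective_injective_map_diff_diff_of_locallyFlat [SecondCountableTopology N] {W T₀ T₁ : Set N}
    (hT₀ : IsClosed T₀) (h₁₀ : T₁ ⊆ T₀) (k : ℕ)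
    (hflat : ∀ x : ↥(W \ T₁), (x : N) ∈ T₀ → ∃ (F : Type) (_ : NormedAddCommGroup F)
      (_ : NormedSpace ℝ F) (_ : FiniteDimensional ℝ F) (K : Type) (_ : NormedAddCommGroup K)
      (_ : NormedSpace ℝ K) (e : OpenPartialHomeomorph ↥(W \ T₁) (F × K)),
      k ≤ Module.finrank ℝ F ∧ x ∈ e.source ∧
        ∀ z ∈ e.source, (z : N) ∈ T₀ ↔ (e z).1 = 0) :
    (∀ q, q < k → Function.Surjective (singularHomology.map R M
        (subsetInclusion (sdiff_le_sdiff_left h₁₀ : W \ T₀ ⊆ W \ T₁)) q)) ∧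
      ∀ q, q + 1 < k → Function.Injective (singularHomology.map R M
        (subsetInclusion (sdiff_le_sdiff_left h₁₀ : W \ T₀ ⊆ W \ T₁)) q) := by
  haveI : SecondCountableTopology ↥(W \ T₁) := TopologicalSpace.Subtype.secondCountableTopology _
  set S : Set ↥(W \ T₁) := {x | (x : N) ∈ T₀} with hSdef
  have hS : IsClosed S := hT₀.preimage continuous_subtype_val
  have hflat' : ∀ x ∈ S, ∃ (F : Type) (_ : NormedAddCommGroup F) (_ : NormedSpace ℝ F)
      (_ : FiniteDimensional ℝ F) (K : Type) (_ : NormedAddCommGroup K) (_ : NormedSpace ℝ K)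
      (e : OpenPartialHomeomorph ↥(W \ T₁) (F × K)),
      k ≤ Module.finrank ℝ F ∧ x ∈ e.source ∧ ∀ z ∈ e.source, z ∈ S ↔ (e z).1 = 0 :=
    fun x hx ↦ hflat x hx
  have heng := surjective_injective_map_compl_of_locallyFlat R M hS k hflat'
  -- `{x : W ∖ T₁ | x ∉ T₀} ≃ₜ W ∖ T₀`
  let eA : ↥Sᶜ ≃ₜ ↥(W \ T₀) :=
    { toFun := fun x ↦ ⟨x.1.1, x.1.2.1, x.2⟩
      invFun := fun y ↦ ⟨⟨y.1, y.2.1, fun h ↦ y.2.2 (h₁₀ h)⟩, y.2.2⟩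
      left_inv := fun _ ↦ rfl
      right_inv := fun _ ↦ rfl
      continuous_toFun := by fun_prop
      continuous_invFun := by fun_prop }
  have hc : ((Homeomorph.refl ↥(W \ T₁) : _ ≃ₜ _) : C(↥(W \ T₁), ↥(W \ T₁))).comp (subsetIncl Sᶜ) =
      (subsetInclusion (sdiff_le_sdiff_left h₁₀ : W \ T₀ ⊆ W \ T₁)).comp (eA : C(↥Sᶜ, ↥(W \ T₀))) :=
    ContinuousMap.ext fun _ ↦ rfl
  refine ⟨fun q hq ↦ (surjective_map_iff_of_homeomorph R M _ _ _ _ hc q).1 (heng.1 q hq),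
    fun q hq ↦ (injective_map_iff_of_homeomorph R M _ _ _ _ hc q).1 (heng.2 q hq)⟩

variable [SecondCountableTopology N]

omit [SecondCountableTopology N] in
/-- **The singular stratification terminates**: if every regular point of the analytic set `Z` has
codimension `> dim E`, then `Z = ∅` (regular points are dense in `Z`,
`IsAnalyticSet.subset_closure_regularLocus_holds`, and have codimension `≤ dim E`). Same statement as
`IsAnalyticSet.eq_empty_of_finrank_lt_codim` of `RiemannExtensionCodimTwo.lean`, re-derived here to
keep the import cone small. [folklore] -/
theorem IsAnalyticSet.eq_empty_of_finrank_lt_codim_of_subset_closure {Z : Set N}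
    (hZ : IsAnalyticSet 𝓘(ℂ, E) Z) {c₀ : ℕ}
    (hc₀ : ∀ z c, z ∈ Z → IsRegularPointOfCodim 𝓘(ℂ, E) Z c z → c₀ ≤ c)
    (hlt : Module.finrank ℂ E < c₀) : Z = ∅ := by
  have hreg : regularLocus 𝓘(ℂ, E) Z = ∅ := by
    rw [eq_empty_iff_forall_notMem]
    rintro z ⟨hz, c, hc⟩
    have := hc₀ z c hz hc
    have := hc.le_finrank
    omega
  have h := IsAnalyticSet.subset_closure_regularLocus_holds (I := 𝓘(ℂ, E)) (M := N) hZ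
  rw [hreg, closure_empty, subset_empty_iff] at h
  exact h

/-- **Semipurity for analytic subsets of complex manifolds** (Voisin I, Lemma 11.13 along the
singular stratification; Grothendieck's `Nᶜ Hⁱ = 0` for `i < 2c`, analytic form). Let `N` be a
second countable complex manifold charted on the finite-dimensional complex space `E`, `T ⊆ N` an
analytic subset all of whose regular points have codimension `≥ c₀`, and `W ⊆ N` open. Then the
map `H_q(W ∖ T; M) → H_q(W; M)` induced by the inclusion is onto for `q < 2c₀` and one-to-one for
`q + 1 < 2c₀`. Proof: downward induction along `T ⊇ sng T ⊇ sng² T ⊇ ⋯ ⊇ ∅` (Cartan–Whitney,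
`isAnalyticSet_singularLocus_holds`; `IsAnalyticSet.succ_le_codim_singularLocus`;
`IsAnalyticSet.eq_empty_of_finrank_lt_codim`), each stratum `reg T_k` being locally flat of real
codimension `≥ 2c₀` in `W ∖ T_{k+1}` (`IsRegularPointOfCodim.exists_straightening`) so that the
tree's engine applies (`surjective_injective_map_diff_diff_of_locallyFlat`).
[cite: VoisinHodgeI2002, §11.1.2 Lemma 11.13 and §11.1.1 Thm. 11.11] [cite: Chirka1989, §5.2 Thm. 2] -/
theorem IsAnalyticSet.surjective_injective_map_diff {T : Set N} (hT : IsAnalyticSet 𝓘(ℂ, E) T)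
    {c₀ : ℕ} (hc₀ : ∀ z c, z ∈ T → IsRegularPointOfCodim 𝓘(ℂ, E) T c z → c₀ ≤ c)
    {W : Set N} (hW : IsOpen W) :
    (∀ q, q < 2 * c₀ → Function.Surjective
        (singularHomology.map R M (subsetInclusion (sdiff_subset : W \ T ⊆ W)) q)) ∧
      ∀ q, q + 1 < 2 * c₀ → Function.Injective
        (singularHomology.map R M (subsetInclusion (sdiff_subset : W \ T ⊆ W)) q) := by
  classical
  -- the singular stratification `T ⊇ sng T ⊇ sng² T ⊇ ⋯`
  set S : ℕ → Set N := fun k ↦ Nat.rec T (fun _ Z ↦ singularLocus 𝓘(ℂ, E) Z) k with hS_def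
  have hS0 : S 0 = T := rfl
  have hSs : ∀ k, S (k + 1) = singularLocus 𝓘(ℂ, E) (S k) := fun k ↦ rfl
  have hSan : ∀ k, IsAnalyticSet 𝓘(ℂ, E) (S k) := by
    intro k
    induction k with
    | zero => exact hT
    | succ k ih => rw [hSs]; exact isAnalyticSet_singularLocus_holds 𝓘(ℂ, E) N ih
  have hScl : ∀ k, IsClosed (S k) := fun k ↦ (hSan k).isClosed
  have hSsub : ∀ k, S (k + 1) ⊆ S k := fun k ↦ by rw [hSs]; exact sdiff_subset
  have hScodim : ∀ k z c, z ∈ S k → IsRegularPointOfCodim 𝓘(ℂ, E) (S k) c z → c₀ + k ≤ c := by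
    intro k
    induction k with
    | zero => simpa [hS0] using hc₀
    | succ k ih =>
      intro z c hz hreg
      rw [hSs] at hz hreg
      have := (hSan k).succ_le_codim_singularLocus ih hz hreg
      omega
  have hSempty : S (Module.finrank ℂ E + 1) = ∅ :=
    (hSan (Module.finrank ℂ E + 1)).eq_empty_of_finrank_lt_codim_of_subset_closure
      (c₀ := c₀ + (Module.finrank ℂ E + 1))
      (hScodim (Module.finrank ℂ E + 1)) (by omega)
  -- downward induction along the stratification
  suffices key : ∀ j k, j + k = Module.finrank ℂ E + 1 →
      (∀ q, q < 2 * c₀ → Function.Surjective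
        (singularHomology.map R M (subsetInclusion (sdiff_subset : W \ S k ⊆ W)) q)) ∧
      ∀ q, q + 1 < 2 * c₀ → Function.Injective
        (singularHomology.map R M (subsetInclusion (sdiff_subset : W \ S k ⊆ W)) q) from
    key (Module.finrank ℂ E + 1) 0 (by omega)
  intro j
  induction j with
  | zero =>
    intro k hk
    rw [zero_add] at hk
    subst hk
    rw [hSempty]
    exact ⟨fun q _ ↦ (surjective_injective_map_diff_empty R M W q).1,
      fun q _ ↦ (surjective_injective_map_diff_empty R M W q).2⟩
  | succ j ih =>
    intro k hk
    have ih₁ := ih (k + 1) (by omega)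
    -- the stratum `S k ∖ S (k+1) = reg (S k)` is locally flat in `W ∖ S (k+1)`
    have hstep := surjective_injective_map_diff_diff_of_locallyFlat R M (W := W) (hScl k)
      (hSsub k) (2 * c₀) (fun x hx ↦ by
        -- `x` is a regular point of `S k`, of some codimension `q ≥ c₀ + k`
        have hxreg : (x : N) ∈ regularLocus 𝓘(ℂ, E) (S k) := by
          have hx1 : (x : N) ∉ singularLocus 𝓘(ℂ, E) (S k) := fun h ↦ x.2.2 ((hSs k).symm.subset h)
          by_contra h
          exact hx1 ⟨hx, h⟩
        obtain ⟨hxS, q, hq⟩ := hxreg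
        obtain ⟨K, e, hxe, heS⟩ := hq.exists_straightening
        let s : Opens N := ⟨W \ S (k + 1), hW.sdiff (hScl (k + 1))⟩
        refine ⟨Fin q → ℂ, inferInstance, inferInstance, inferInstance, ↥K, inferInstance,
          inferInstance, e.subtypeRestr (s := s) ⟨x⟩, ?_, ?_, fun z hz ↦ ?_⟩
        · -- `dim_ℝ ℂ^q = 2q` (the tree's `Geometry.GeometricMeasureTheory.finrank_real_pi_complex`,
          -- re-derived rather than imported from the measure-theory files)
          have hfr : Module.finrank ℝ (Fin q → ℂ) = 2 * q := by
            rw [Module.finrank_pi_fintype, Finset.sum_const, Finset.card_univ, Fintype.card_fin,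
              Complex.finrank_real_complex, smul_eq_mul, mul_comm]
          rw [hfr]
          exact Nat.mul_le_mul_left 2 ((hScodim k x q hxS hq).trans' (Nat.le_add_right _ _))
        · rw [OpenPartialHomeomorph.subtypeRestr_source]
          exact hxe
        · rw [OpenPartialHomeomorph.subtypeRestr_source] at hz
          exact heS z hz)
    -- compose `W ∖ S k ↪ W ∖ S (k+1) ↪ W`
    have hcomp : (subsetInclusion (sdiff_subset : W \ S (k + 1) ⊆ W)).comp
        (subsetInclusion (sdiff_le_sdiff_left (hSsub k) : W \ S k ⊆ W \ S (k + 1))) =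
        subsetInclusion (sdiff_subset : W \ S k ⊆ W) :=
      ContinuousMap.ext fun _ ↦ rfl
    refine ⟨fun q hq ↦ ?_, fun q hq ↦ ?_⟩
    · rw [← hcomp, singularHomology.map_comp]
      exact (ih₁.1 q hq).comp (hstep.1 q hq)
    · rw [← hcomp, singularHomology.map_comp]
      exact (ih₁.2 q hq).comp (hstep.2 q hq)

/-- **`H_q(N ∖ T) → H_q(N)` is onto for `q < 2c₀` and one-to-one for `q + 1 < 2c₀`** for an analytic
subset `T` all of whose regular points have codimension `≥ c₀` (the case `W = N` of
`IsAnalyticSet.surjective_injective_map_diff`, for the inclusion of the subtype `{x // x ∉ T}`).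
[cite: VoisinHodgeI2002, §11.1.2 Lemma 11.13] -/
theorem IsAnalyticSet.surjective_injective_map_compl {T : Set N} (hT : IsAnalyticSet 𝓘(ℂ, E) T)
    {c₀ : ℕ} (hc₀ : ∀ z c, z ∈ T → IsRegularPointOfCodim 𝓘(ℂ, E) T c z → c₀ ≤ c) :
    (∀ q, q < 2 * c₀ → Function.Surjective (singularHomology.map R M (subsetIncl Tᶜ) q)) ∧
      ∀ q, q + 1 < 2 * c₀ → Function.Injective (singularHomology.map R M (subsetIncl Tᶜ) q) := by
  have h := hT.surjective_injective_map_diff R M hc₀ isOpen_univ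
  have hc : ((Homeomorph.Set.univ N : ↥(univ : Set N) ≃ₜ N) : C(↥(univ : Set N), N)).comp
      (subsetInclusion (sdiff_subset : univ \ T ⊆ univ)) =
      (subsetIncl Tᶜ).comp ((Homeomorph.setCongr (compl_eq_univ_sdiff T).symm :
        ↥(univ \ T) ≃ₜ ↥Tᶜ) : C(↥(univ \ T), ↥Tᶜ)) :=
    ContinuousMap.ext fun _ ↦ rfl
  exact ⟨fun q hq ↦ (surjective_map_iff_of_homeomorph R M _ _ _ _ hc q).1 (h.1 q hq),
    fun q hq ↦ (injective_map_iff_of_homeomorph R M _ _ _ _ hc q).1 (h.2 q hq)⟩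

end Literature.Geometry.Kaehler

end
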